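import Summits.CriticalPhenomena.PercolationContinuityZ3.Theorems.PercNearOneGluingNoHeavyQuantShapeForestTight
import HarnessLib

/-!
# QUANT lane R8, T-DEC: EVERY FOREST OF GLUED SIBLINGS `R^{loᵢ}[qᵢ](R^{Kᵢ}[gᵢ])` OF ARBITRARY, MIXED SHAPES WITH AT MOST ONE TIGHT SIBLING IS SDEC AT
# EVERY TREE-OK FLOOR — any parameters, every width, any tail lengths, no oracle (census-1 gen 34; the shape-free form of `sdec_shapeForests_of_oneTight`)

builds on p205010 (kernel theorem, internal audit signed; external expert review pending)

Support file (`--supports stmt-CriticalPhenomena-4575`), QUANT lane seat prim-quant-census-1 (gen 34); memo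
`run/shared/lean/prim/quant/prim-quant-census-1/g34/FOREST3-G34.md` §2.  Theorems only (no definitions), standard axioms, no sorries.  Uses
`shapeSib_tame_of_notTight` (`…QuantShapeForestTight`), `shapeSib_facts` (`…QuantShapeForestLong`), `sdec_shapeSib` / `shapeSib_laws` (`…QuantShapeSibling`),
`sdec_append_tame` / `sdec_flaw_perm` (`…QuantResidueForestsAll`), `sdec_append_good` (`…QuantGoodSiblingsCore`).

THE POINT.  The tight-sibling reduction of `…QuantShapeForestTight` is shape-by-shape: a glued sibling `⟨q,·,·,lo+K,{lo: 1−g, lo+K: g}⟩` is tame at the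
floor `x` unless `2lo < q(lo+Kg) < lo + K·x`, whatever the other siblings are.  So when at most ONE sibling of the whole forest is tight, no hub of any
shape is needed: that sibling alone is SDEC (`sdec_shapeSib`, any `lo, K ≥ 1`) and everything else is adjoined by arm-1 g57's tame step.  The shapes are
given as functions `lo K : Sib → ℕ` of the sibling (so siblings of different shapes — `R²(R³) ⊔ R¹(R⁹) ⊔ R³(R⁴) ⊔ …` — live in one list).
* **`sdec_gluedForests_of_oneTight`** — `0 < x`; `L` any list of glued siblings `s = ⟨q,·,·,lo s + K s,{lo s: 1−g, lo s + K s: g}⟩`, `1 ≤ lo s`,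
  `1 ≤ K s`, `0 < q, g < 1`, `x ≤ qg`; at most one `s ∈ L` tight (`2·lo s < q·mean < lo s + (K s)·x`) ⟹ `SDEC x (ftop L) (flaw L)`.
* **`sdec_forest_gluedOneTightCore`** — THE NODE-SHAPED FORM: good siblings (tame or hull+high, any sub-trees) + glued siblings of arbitrary shapes with
  at most one tight one, in any order, are SDEC at `x` (`0 < x < 1`).
At the tree-OK floor `x = min qᵢgᵢ` sibling `j` is tight iff it is heavy and `qⱼgⱼ − x < loⱼ(1−qⱼ)/Kⱼ`; two siblings are tight together only when their
product floors nearly coincide — the residue of the sibling step on glued forests is the COINCIDENT-FLOOR corner (≥ 2 tight: one-shape families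
`…QuantShapeForestTight`; mixed shapes open).

HONEST STATUS.  `≥ 2` tight glued siblings of different shapes, 4-chains, deeper sub-trees stay open; `SiblingStep`, `GluedDominatedMass`, `SDECConvClosed`,
`FarTreeRow` OPEN; RATE class (log\*) / honest sentence of `run/shared/lean/prim/quant/README.md` unchanged.  [this work].  Nothing here is cited as a
published result.  The gluing rows served [cite: KozmaNitzan2024, Conjecture 3 (p. 15)]; product measure [cite: Grimmett1999, §1.3 p. 10].
-/

noncomputable section

open scoped BigOperators

namespace Summit.CriticalPhenomena.PercolationContinuityZ3.Theorems
namespace Quant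
namespace LawDec

open Finset

/-- the sub-forest law of the glued sibling of shape `(lo, K)`: `S(g) = {lo: 1−g, lo+K: g}` -/
local notation3 "SP[" lo ", " K ", " a "]" => (fun h : ℕ => (1 - (a : ℝ)) * (if h = (lo : ℕ) then (1 : ℝ) else 0) +
  (a : ℝ) * (if h = (lo : ℕ) + (K : ℕ) then (1 : ℝ) else 0))

/-! ### Mixed shapes, at most one tight sibling -/

/-- a list of AT MOST ONE glued sibling of whatever shape (`lo s, K s ≥ 1`, `0 < q, g < 1`, `x ≤ qg`, `0 < x`) is SDEC: `sdec_shapeSib`. [this work] -/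
theorem sdec_gluedSibs_le_one (lo K : Sib → ℕ) {x : ℝ} (hx0 : 0 < x) : ∀ L : List Sib, L.length ≤ 1 →
    (∀ s ∈ L, 1 ≤ lo s ∧ 1 ≤ K s ∧ s.M = lo s + K s ∧ 0 < s.q ∧ s.q < 1 ∧
      ∃ g : ℝ, 0 < g ∧ g < 1 ∧ s.ρ = SP[lo s, K s, g] ∧ x ≤ s.q * g) →
    SDEC x (ftop L) (flaw L)
  | [], _, _ => by intro q _ _ j' hj'; exact absurd hj' (Nat.not_lt_zero _)
  | [s], _, hL => by
    obtain ⟨hlo, hK, hM, hq0, hq1, g, hg0, hg1, hρ, hx⟩ := hL s (by simp)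
    obtain ⟨_, tM, _, _⟩ := shapeSib_laws (lo s) (K s) hq0.le hq1.le hg0.le hg1.le
    have e1 : flaw [s] = gate SP[lo s, K s, g] s.q := by
      show lconv (ftop []) s.M (flaw []) (gate s.ρ s.q) = _
      rw [hM, hρ]; exact funext fun h => lconv_delta_left 0 _ _ tM h
    have e2 : ftop [s] = lo s + K s := by show 0 + s.M = lo s + K s; omega
    rw [e1, e2]
    exact sdec_shapeSib (lo s) (K s) hlo hK hx0 hq0 hq1 hg1 hx
  | _ :: _ :: _, h2, _ => by simp at h2

/-- **EVERY FOREST OF GLUED SIBLINGS OF ARBITRARY (MIXED) SHAPES WITH AT MOST ONE TIGHT SIBLING IS SDEC AT EVERY TREE-OK FLOOR — ANY PARAMETERS, EVERY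
WIDTH, ANY TAIL LENGTHS, NO ORACLE.**  Shapes as functions `lo K : Sib → ℕ`; `L`: siblings `s = ⟨q,·,·,lo s + K s,{lo s: 1−g, lo s + K s: g}⟩` with
`1 ≤ lo s`, `1 ≤ K s`, `0 < q, g < 1`, `x ≤ qg`; `0 < x`; `(L.filter (2·lo s < q·mean < lo s + (K s)·x)).length ≤ 1` ⟹ `SDEC x (ftop L) (flaw L)`.
[this work] -/
theorem sdec_gluedForests_of_oneTight (lo K : Sib → ℕ) {x : ℝ} (hx0 : 0 < x) (L : List Sib)
    (hL : ∀ s ∈ L, 1 ≤ lo s ∧ 1 ≤ K s ∧ s.M = lo s + K s ∧ 0 < s.q ∧ s.q < 1 ∧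
      ∃ g : ℝ, 0 < g ∧ g < 1 ∧ s.ρ = SP[lo s, K s, g] ∧ x ≤ s.q * g)
    (hone : (L.filter (fun s => decide (2 * (lo s : ℝ) < s.q * s.mean ∧ s.q * s.mean < (lo s : ℝ) + (K s) * x))).length ≤ 1) :
    SDEC x (ftop L) (flaw L) := by
  by_cases hnil : L = []
  · subst hnil; intro q _ _ j' hj'; exact absurd hj' (Nat.not_lt_zero _)
  obtain ⟨s₀, hs₀⟩ := List.exists_mem_of_ne_nil L hnil
  have hx1 : x < 1 := by
    obtain ⟨_, _, _, hq0, hq1, g, hg0, hg1, _, hx⟩ := hL s₀ hs₀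
    nlinarith
  have facts : ∀ s ∈ L, s.LawOK ∧ x * (s.M : ℝ) ≤ s.q * s.mean := fun s hs =>
    ⟨(shapeSib_facts (lo s) (K s) (hL s hs).1 s (hL s hs).2.2).1, (shapeSib_facts (lo s) (K s) (hL s hs).1 s (hL s hs).2.2).2.1⟩
  have hperm : (L.filter (fun s => !decide (2 * (lo s : ℝ) < s.q * s.mean ∧ s.q * s.mean < (lo s : ℝ) + (K s) * x)) ++
      L.filter (fun s => decide (2 * (lo s : ℝ) < s.q * s.mean ∧ s.q * s.mean < (lo s : ℝ) + (K s) * x))).Perm L :=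
    (List.perm_append_comm).trans (List.filter_append_perm _ L)
  refine sdec_flaw_perm hperm ?_
  refine sdec_append_tame hx0 hx1 _ (fun t ht => (facts t (List.mem_of_mem_filter ht)).1)
    (fun t ht => (facts t (List.mem_of_mem_filter ht)).2)
    (sdec_gluedSibs_le_one lo K hx0 _ hone (fun s hs => hL s (List.mem_of_mem_filter hs))) _
    (fun s hs => (facts s (List.mem_of_mem_filter hs)).1) (fun s hs => (facts s (List.mem_of_mem_filter hs)).2) ?_
  intro s hs
  obtain ⟨hsL, hb⟩ := List.mem_filter.1 hs
  have hnt : ¬ (2 * (lo s : ℝ) < s.q * s.mean ∧ s.q * s.mean < (lo s : ℝ) + (K s) * x) := by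
    intro hc
    simp [hc.1, hc.2] at hb
  exact shapeSib_tame_of_notTight (lo s) (K s) s (hL s hsL).2.2 hnt

/-! ### The node-shaped form -/

/-- **THE SIBLING STEP FOR EVERY FOREST OF GOOD SIBLINGS AND GLUED SIBLINGS OF ARBITRARY SHAPES WITH AT MOST ONE TIGHT ONE — NO ORACLE.**  For
`0 < x < 1`, shapes `lo K : Sib → ℕ`, any list `Lg` of siblings GOOD at `x` (law-OK, `x·M ≤ q·mean`, tame or hull+high — any sub-trees), any list `Lc`
of glued siblings `⟨q,·,·,lo s + K s,{lo s: 1−g, lo s + K s: g}⟩` (`1 ≤ lo s, K s`, `0 < q, g < 1`, `x ≤ qg`) with at most one tight member, and every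
forest `L ~ Lg ++ Lc`: `SDEC x (ftop L) (flaw L)`. [this work] -/
theorem sdec_forest_gluedOneTightCore (lo K : Sib → ℕ) {x : ℝ} (hx0 : 0 < x) (hx1 : x < 1) (Lg Lc L : List Sib)
    (hLg : ∀ s ∈ Lg, s.LawOK ∧ x * (s.M : ℝ) ≤ s.q * s.mean ∧
      ((∀ h : ℕ, 1 ≤ h → s.ρ h ≠ 0 → s.q * s.mean ≤ 2 * h ∨ x * ((s.M : ℝ) - h) ≤ s.q * s.mean - h) ∨
        HullHigh x (s.q * s.mean) s.M (gate s.ρ s.q)))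
    (hLc : ∀ s ∈ Lc, 1 ≤ lo s ∧ 1 ≤ K s ∧ s.M = lo s + K s ∧ 0 < s.q ∧ s.q < 1 ∧
      ∃ g : ℝ, 0 < g ∧ g < 1 ∧ s.ρ = SP[lo s, K s, g] ∧ x ≤ s.q * g)
    (hone : (Lc.filter (fun s => decide (2 * (lo s : ℝ) < s.q * s.mean ∧ s.q * s.mean < (lo s : ℝ) + (K s) * x))).length ≤ 1)
    (hperm : (Lg ++ Lc).Perm L) :
    SDEC x (ftop L) (flaw L) := by
  have fc : ∀ s ∈ Lc, s.LawOK ∧ x * (s.M : ℝ) ≤ s.q * s.mean := fun s hs =>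
    ⟨(shapeSib_facts (lo s) (K s) (hLc s hs).1 s (hLc s hs).2.2).1, (shapeSib_facts (lo s) (K s) (hLc s hs).1 s (hLc s hs).2.2).2.1⟩
  refine sdec_flaw_perm hperm ?_
  exact sdec_append_good hx0 hx1 Lc (fun t ht => (fc t ht).1) (fun t ht => (fc t ht).2) (sdec_gluedForests_of_oneTight lo K hx0 Lc hLc hone) Lg
    (fun s hs => (hLg s hs).1) (fun s hs => (hLg s hs).2.1) (fun s hs => (hLg s hs).2.2)

end LawDec
end Quant
end Summit.CriticalPhenomena.PercolationContinuityZ3.Theorems
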